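import Summits.ResolutionOfSingularities.ResolutionOfSingularities.Theorems.RadicialJungCleanModelsLocalMonomializationAlongCoarsening
import Literature.AlgebraicGeometry.Resolution.RankOneReductionProofs
import HarnessLib

/-!
# Unit-adjunction normalisation: a centre of `ν₁` generated by `Y` LOCALLY at the centre of `ν` becomes generated by `Y` in the MODEL

Route `RadicialJung`, crux `CleanModels` (stmt-ResolutionOfSingularities-15917), registered skeleton `Cruxes/CleanModels/Lines/Sketch.lean`
rev 35 (sha16 de44649d8f729c3b), stub 7 `stub_cleanModelsDimGEFour`.  Explicit-unit seat `decomp-res-hand-2` g5 (structural hand); memo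
`Cruxes/CleanModels/Lines/Sketch-memo-hand2-g5-stubs-5-7.md` §2.  OURS; structural bookkeeping, counted 0; nothing here proves resolution of
singularities in characteristic `p`.

In the repaired Novacoski–Spivakovsky §3.2 combination (g4 memo §2b) the bricks `blowupAlong_generators_of_centre` / `absorption_step` consume
the MODEL-LEVEL hypothesis `𝔭 = (Y) · A` (the centre of `ν₁` on the affine model `A` is generated by the finite set `Y`), whereas the natural
output of a lifting step is only the LOCAL statement `𝔭 · A_𝔮 = (Y) · A_𝔮` at the centre `𝔮` of `ν`.  The two are reconciled for free:

* `exists_model_centre_eq_span_of_local` — if every `π ∈ 𝔭` has `s · π ∈ (Y) · A` for some `s ∈ A` with `ν(s) = 0` (a unit at `𝔮`), then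
  adjoining the inverse of ONE such unit `S` (the product of the `s` over a finite generating set of `𝔭`) gives a finitely generated model
  `A' = A[1/S] ⊆ O` with the SAME local rings at the centres of `ν` and of `ν₁` and with `𝔭' = (Y) · A'` on the nose (same `Y`, same
  cardinality).  [folklore]
-/

noncomputable section

set_option linter.dupNamespace false -- mandated namespace of this single-conjunct summit

open IsLocalRing
open Literature.AlgebraicGeometry.Resolution

namespace Summit.ResolutionOfSingularities.ResolutionOfSingularities.Theorems.RadicialJung.CleanModels

variable {k K : Type} [Field k] [Field K] [Algebra k K]

/-- **Unit-adjunction normalisation.** Let `O ≤ O₁` be valuation rings of `K`, `A ⊆ O` a finitely generated model, `Y ⊆ A` a finite set of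
elements of positive `ν₁`-value, and suppose the centre `𝔭` of `ν₁` on `A` is generated by `Y` LOCALLY at the centre of `ν`: every `π ∈ 𝔭` has
`s · π ∈ (Y) · A` for some `s ∈ A` with `ν(s) = 0`.  Then there is a finitely generated model `A ⊆ A' ⊆ O` with
`locAtCentre A' O = locAtCentre A O`, `locAtCentre A' O₁ = locAtCentre A O₁`, and whose centre of `ν₁` is generated, as an ideal of `A'`, by
(the image of) `Y`. [folklore] -/
theorem exists_model_centre_eq_span_of_local (O O₁ : ValuationSubring K) (hO : O ≤ O₁)
    (A : Subalgebra k K) (hA : A.toSubring ≤ O.toSubring) (hAfg : A.FG)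
    (Y : Finset A.toSubring) (hYP : ∀ y ∈ Y, O₁.valuation ((y : A.toSubring) : K) < 1)
    (hloc : ∀ π : A.toSubring, O₁.valuation (π : K) < 1 →
      ∃ s : A.toSubring, O.valuation (s : K) = 1 ∧ s * π ∈ Ideal.span (Y : Set A.toSubring)) :
    ∃ (A' : Subalgebra k K) (hA' : A'.toSubring ≤ O.toSubring), A ≤ A' ∧ A'.FG ∧
      locAtCentre A'.toSubring O = locAtCentre A.toSubring O ∧
      locAtCentre A'.toSubring O₁ = locAtCentre A.toSubring O₁ ∧
      ∃ Y' : Finset A'.toSubring, Y'.card = Y.card ∧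
        (∀ y' : A'.toSubring, y' ∈ Y' ↔ ∃ y ∈ Y, ((y : A.toSubring) : K) = (y' : K)) ∧
        (maximalIdeal O₁).comap (Subring.inclusion (hA'.trans hO)) = Ideal.span (Y' : Set A'.toSubring) := by
  classical
  haveI hnoeth : IsNoetherianRing A.toSubring := isNoetherianRing_of_fg hAfg
  have hAO₁ : A.toSubring ≤ O₁.toSubring := hA.trans hO
  set P := ((maximalIdeal O₁).comap (Subring.inclusion hAO₁)) with hPdef
  have hmemP : ∀ g : A.toSubring, g ∈ P ↔ O₁.valuation (g : K) < 1 := fun g => by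
    rw [hPdef, Ideal.mem_comap, ValuationSubring.valuation_lt_one_iff]; rfl
  -- a finite generating set of `𝔭` and the unit `S`
  obtain ⟨sgen, hsgen⟩ := (IsNoetherian.noetherian P : P.FG)
  have hsgenP : ∀ p ∈ sgen, p ∈ P := fun p hp => hsgen ▸ Ideal.subset_span hp
  have hch : ∀ p : A.toSubring, p ∈ P → ∃ s : A.toSubring, O.valuation (s : K) = 1 ∧
      s * p ∈ Ideal.span (Y : Set A.toSubring) := fun p hp => hloc p ((hmemP p).mp hp)
  choose s hs1 hsY using hch
  let s' : A.toSubring → A.toSubring := fun p => if hp : p ∈ P then s p hp else 1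
  have hs'1 : ∀ p, O.valuation ((s' p : A.toSubring) : K) = 1 := by
    intro p
    by_cases hp : p ∈ P
    · simp only [s', dif_pos hp]; exact hs1 p hp
    · simp only [s', dif_neg hp, OneMemClass.coe_one, map_one]
  have hs'Y : ∀ p ∈ sgen, s' p * p ∈ Ideal.span (Y : Set A.toSubring) := by
    intro p hp
    simp only [s', dif_pos (hsgenP p hp)]; exact hsY p _
  set S : A.toSubring := ∏ p ∈ sgen, s' p with hSdef
  have hS1 : O.valuation (S : K) = 1 := by
    rw [hSdef]; push_cast
    rw [map_prod]
    exact Finset.prod_eq_one fun p _ => hs'1 p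
  have hS0 : (S : K) ≠ 0 := ne_zero_of_valuation_eq_one hS1
  have hSO : (S : K) ∈ O := hA S.2
  have hSinv1 : O.valuation (S : K)⁻¹ = 1 := by rw [map_inv₀, hS1, inv_one]
  have hSinvO : (S : K)⁻¹ ∈ O := (O.valuation_le_one_iff _).mp hSinv1.le
  have hS₁1 : O₁.valuation (S : K) = 1 := by
    apply le_antisymm ((O₁.valuation_le_one_iff _).mpr (hO hSO))
    have h : O₁.valuation (S : K)⁻¹ ≤ 1 := (O₁.valuation_le_one_iff _).mpr (hO hSinvO)
    rw [map_inv₀] at h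
    have hpos : 0 < O₁.valuation (S : K) := by
      rw [Valuation.pos_iff]; exact hS0
    exact (inv_le_one₀ hpos).mp h
  -- the model `A' = A[1/S]`, presented by its normal form
  let T : Subalgebra k K :=
    { carrier := {f | ∃ N : ℕ, f * (S : K) ^ N ∈ A}
      mul_mem' := by
        rintro f g ⟨N, hf⟩ ⟨M, hg⟩
        refine ⟨N + M, ?_⟩
        have : f * g * (S : K) ^ (N + M) = (f * (S : K) ^ N) * (g * (S : K) ^ M) := by ring
        rw [this]; exact A.mul_mem hf hg
      one_mem' := ⟨0, by simp⟩
      add_mem' := by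
        rintro f g ⟨N, hf⟩ ⟨M, hg⟩
        refine ⟨N + M, ?_⟩
        have : (f + g) * (S : K) ^ (N + M) = (f * (S : K) ^ N) * (S : K) ^ M + (g * (S : K) ^ M) * (S : K) ^ N := by ring
        rw [this]
        exact A.add_mem (A.mul_mem hf (A.pow_mem S.2 M)) (A.mul_mem hg (A.pow_mem S.2 N))
      zero_mem' := ⟨0, by simp⟩
      algebraMap_mem' := fun c => ⟨0, by simp⟩ }
  have hAT : A ≤ T := fun f hf => ⟨0, by simpa using hf⟩
  have hinvT : (S : K)⁻¹ ∈ T := ⟨1, by rw [pow_one, inv_mul_cancel₀ hS0]; exact A.one_mem⟩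
  have hTeq : T = A ⊔ Algebra.adjoin k ((({(S : K)⁻¹} : Finset K)) : Set K) := by
    apply le_antisymm
    · rintro f ⟨N, hf⟩
      have : f = (f * (S : K) ^ N) * ((S : K)⁻¹) ^ N := by
        rw [inv_pow, mul_assoc, mul_inv_cancel₀ (pow_ne_zero N hS0), mul_one]
      rw [this]
      refine Subalgebra.mul_mem _ (le_sup_left (b := Algebra.adjoin k _) hf)
        (Subalgebra.pow_mem _ (le_sup_right (a := A) (Algebra.subset_adjoin (by simp))) N)
    · exact sup_le hAT (Algebra.adjoin_le (by simpa using hinvT))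
  have hTfg : T.FG := by rw [hTeq]; exact hAfg.sup ⟨_, rfl⟩
  have hTO : T.toSubring ≤ O.toSubring := by
    rintro f ⟨N, hf⟩
    have hval : O.valuation f ≤ 1 := by
      have h1 : O.valuation (f * (S : K) ^ N) ≤ 1 := (O.valuation_le_one_iff _).mpr (hA hf)
      rwa [map_mul, map_pow, hS1, one_pow, mul_one] at h1
    exact (O.valuation_le_one_iff _).mp hval
  have hTO₁ : T.toSubring ≤ O₁.toSubring := hTO.trans hO
  -- the local rings are unchanged
  have hTlocO : T.toSubring ≤ locAtCentre A.toSubring O := by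
    rintro f ⟨N, hf⟩
    exact (mem_locAtCentre_iff).mpr ⟨_, hf, (S : K) ^ N, A.pow_mem S.2 N,
      by rw [map_pow, hS1, one_pow], by field_simp⟩
  have hTlocO₁ : T.toSubring ≤ locAtCentre A.toSubring O₁ := by
    rintro f ⟨N, hf⟩
    exact (mem_locAtCentre_iff).mpr ⟨_, hf, (S : K) ^ N, A.pow_mem S.2 N,
      by rw [map_pow, hS₁1, one_pow], by field_simp⟩
  have hlocO : locAtCentre T.toSubring O = locAtCentre A.toSubring O :=
    locAtCentre_eq_of_mutual_le O T.toSubring A.toSubring hTlocO (fun x hx => le_locAtCentre _ _ (hAT hx))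
  have hlocO₁ : locAtCentre T.toSubring O₁ = locAtCentre A.toSubring O₁ :=
    locAtCentre_eq_of_mutual_le O₁ T.toSubring A.toSubring hTlocO₁ (fun x hx => le_locAtCentre _ _ (hAT hx))
  -- the transported `Y`
  have hAT' : A.toSubring ≤ T.toSubring := fun f hf => hAT hf
  let ιT : A.toSubring →+* T.toSubring := Subring.inclusion hAT'
  have hιT : Function.Injective ιT := Subring.inclusion_injective hAT'
  let emb : A.toSubring ↪ T.toSubring := ⟨ιT, hιT⟩
  let Y' : Finset T.toSubring := Y.map emb
  set P' := ((maximalIdeal O₁).comap (Subring.inclusion hTO₁)) with hP'def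
  have hmemP' : ∀ g : T.toSubring, g ∈ P' ↔ O₁.valuation (g : K) < 1 := fun g => by
    rw [hP'def, Ideal.mem_comap, ValuationSubring.valuation_lt_one_iff]; rfl
  have hY'span : (Ideal.span (Y : Set A.toSubring)).map ιT ≤ Ideal.span (Y' : Set T.toSubring) := by
    rw [Ideal.map_span, Ideal.span_le]
    rintro _ ⟨y, hy, rfl⟩
    exact Ideal.subset_span (Finset.mem_map.mpr ⟨y, hy, rfl⟩)
  refine ⟨T, hTO, hAT, hTfg, hlocO, hlocO₁, Y', Finset.card_map _, ?_, ?_⟩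
  · intro y'
    constructor
    · intro hy'
      obtain ⟨y, hy, rfl⟩ := Finset.mem_map.mp hy'
      exact ⟨y, hy, rfl⟩
    · rintro ⟨y, hy, hyy'⟩
      have : emb y = y' := Subtype.ext hyy'
      exact Finset.mem_map.mpr ⟨y, hy, this⟩
  · apply le_antisymm
    · intro f hf
      obtain ⟨N, hfS⟩ := f.2
      set a : A.toSubring := ⟨(f : K) * (S : K) ^ N, hfS⟩ with hadef
      have haP : a ∈ P := by
        rw [hmemP]
        change O₁.valuation ((f : K) * (S : K) ^ N) < 1
        rw [map_mul, map_pow, hS₁1, one_pow, mul_one]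
        exact (hmemP' f).mp hf
      -- every generator of `𝔭`, hence `a`, lands in `(Y') · A'`
      have hgen : ∀ p ∈ sgen, ιT p ∈ Ideal.span (Y' : Set T.toSubring) := by
        intro p hp
        have h1 : ιT (s' p * p) ∈ Ideal.span (Y' : Set T.toSubring) :=
          hY'span (Ideal.mem_map_of_mem ιT (hs'Y p hp))
        have hinv : ((s' p : A.toSubring) : K)⁻¹ ∈ T := by
          refine ⟨1, ?_⟩
          have hprod : ((s' p : A.toSubring) : K) * (((∏ x ∈ sgen.erase p, s' x : A.toSubring)) : K) = (S : K) := by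
            rw [hSdef]; push_cast
            rw [Finset.mul_prod_erase sgen (fun x => ((s' x : A.toSubring) : K)) hp]
          rw [pow_one, ← hprod, ← mul_assoc, inv_mul_cancel₀ (ne_zero_of_valuation_eq_one (hs'1 p)), one_mul]
          exact (∏ x ∈ sgen.erase p, s' x : A.toSubring).2
        have : ιT p = ιT (s' p * p) * ⟨_, hinv⟩ := by
          apply Subtype.ext
          change ((p : A.toSubring) : K) = ((s' p : A.toSubring) : K) * (p : K) * ((s' p : A.toSubring) : K)⁻¹
          rw [mul_comm, ← mul_assoc, inv_mul_cancel₀ (ne_zero_of_valuation_eq_one (hs'1 p)), one_mul]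
        rw [this]
        exact Ideal.mul_mem_right _ _ h1
      have haY' : ιT a ∈ Ideal.span (Y' : Set T.toSubring) := by
        have haspan : a ∈ Submodule.span A.toSubring (sgen : Set A.toSubring) := by rw [hsgen]; exact haP
        refine Submodule.span_induction (p := fun g _ => ιT g ∈ Ideal.span (Y' : Set T.toSubring)) ?_ ?_ ?_ ?_ haspan
        · intro g hg; exact hgen g hg
        · rw [map_zero]; exact Ideal.zero_mem _
        · intro g g' _ _ hg hg'; rw [map_add]; exact Ideal.add_mem _ hg hg'
        · intro r g _ hg; rw [smul_eq_mul, map_mul]; exact Ideal.mul_mem_left _ _ hg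
      have hinvN : ((S : K)⁻¹) ^ N ∈ T := T.pow_mem hinvT N
      have : f = ιT a * ⟨_, hinvN⟩ := by
        apply Subtype.ext
        change (f : K) = ((f : K) * (S : K) ^ N) * ((S : K)⁻¹) ^ N
        rw [inv_pow, mul_assoc, mul_inv_cancel₀ (pow_ne_zero N hS0), mul_one]
      rw [this]
      exact Ideal.mul_mem_right _ _ haY'
    · rw [Ideal.span_le]
      intro y' hy'
      obtain ⟨y, hy, rfl⟩ := Finset.mem_map.mp hy'
      rw [SetLike.mem_coe, hmemP']
      exact hYP y hy

end Summit.ResolutionOfSingularities.ResolutionOfSingularities.Theorems.RadicialJung.CleanModels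

end
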